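import Mathlib
import Summits.ValiantsHypothesis.ValiantsHypothesis.Theorems.RigidityForcesSymmetryRankRigidMinimalReprLaplaceFourDefs
import Summits.ValiantsHypothesis.ValiantsHypothesis.Theorems.RigidityForcesSymmetryRankRigidMinimalReprLaplaceFourContraction
import Summits.ValiantsHypothesis.ValiantsHypothesis.Theorems.RigidityForcesSymmetryRankRigidMinimalReprLaplaceFourLineCore
import Summits.ValiantsHypothesis.ValiantsHypothesis.Theorems.RigidityForcesSymmetryRankRigidMinimalReprLaplaceFourLineE3
import Summits.ValiantsHypothesis.ValiantsHypothesis.Theorems.RigidityForcesSymmetryRankRigidMinimalReprLaplaceFourE3Dichotomy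

/-!
# The border profile `(3,1,1)` of `LaplaceOptimal 4` is impossible exactly
# (crux `RankRigidMinimalRepr`, stmt-ValiantsHypothesis-18034, route `RigidityForcesSymmetry`)

`profile_311`: the permutation pattern `P₄` is NOT of the form
`Σ_{t<3} g_t(v₀,v₁) h_t(v₂,v₃) + b(v₀,v₂) b′(v₁,v₃) + c(v₀,v₃) c′(v₁,v₂)` — three pair terms on `01|23`, one on `02|13`,
one on `03|12` (Laplace weight `20 < 24`).  This is the BORDER class of p8 g8's closed-form degeneration
(`laplaceOptimal_four_border`, `…LaplaceFourBorder.lean`): `P₄` lies in its closure but — as proved here — not in it.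

Proof.  `e3_dichotomy` (twice): after a letter relabelling the arrays are in the normal form of `matching_shape`; the
MIRROR decomposition (slots relabelled by `(01)(23)`, which swaps `b ↔ b′`, `c ↔ c′` and transposes `g_t, h_t`) has a
normal form too, along a matching that must be `{2,3}` (the only symmetric non-zero entries of `b′`), which pins the rows
`2,3` of `b` and `c`.  Then the sixteen matrices `D(e_z,e_w) = Q(e_z,e_w) - (Be_z)(B′e_w)ᵀ - (C′e_w)(Ce_z)ᵀ`, which lie in
the span of the three matrices `h_t`, contain four independent ones (`E^{23}+ρA_{01}`, `E^{01}+ρ′A_{23}` and two of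
`(1±κ)E^{13}, (1±κ)E^{02}, (1∓κ)E^{03}, (1∓κ)E^{12}`) — contradiction.

HONEST FRAMING: a finite tensor statement toward `LaplaceOptimal 4` (rung `TiedTorusBound 3`); the crux stays OPEN;
nothing here bears on `VP ≠ VNP`.
-/

set_option autoImplicit false

-- the mandated summit-side namespace repeats a component by design (single-problem summit)
set_option linter.dupNamespace false

namespace Summit.ValiantsHypothesis.ValiantsHypothesis.Theorems.RigidityForcesSymmetryRankRigidMinimalRepr

namespace LaplaceFourLine

open Module Matrix LaplaceFourContraction

/-! ### §1 Four independent matrices never fit in the span of three -/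

/-- A subspace of dimension `≤ 3` does not contain four linearly independent vectors. -/
theorem four_not_in_span_three (W : Submodule ℂ (Matrix (Fin 4) (Fin 4) ℂ)) (hW : finrank ℂ W ≤ 3)
    (v : Fin 4 → W) (hv : LinearIndependent ℂ v) : False := by
  have := hv.fintype_card_le_finrank
  simp at this
  omega

/-- The mirror symmetry of the pattern: swapping slots `0 ↔ 1` and `2 ↔ 3`. -/
theorem permPattern_mirror (v : Fin 4 → Fin 4) : permPattern₄ ![v 1, v 0, v 3, v 2] = permPattern₄ v := by
  have := congrFun (slotPerm_permPattern (Equiv.swap 0 1 * Equiv.swap 2 3)) v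
  rw [← this]
  simp only [slotPerm]
  congr 1
  funext i
  fin_cases i <;> simp [Equiv.swap_apply_of_ne_of_ne]

/-! ### §2 The profile `(3,1,1)` given the normal form -/

set_option maxHeartbeats 400000 in
/-- The profile `(3,1,1)` with the arrays already in the normal form of `matching_shape`: contradiction. -/
theorem profile_311_of_shape (g h : Fin 3 → Fin 4 → Fin 4 → ℂ) (b b' c c' : Fin 4 → Fin 4 → ℂ)
    (hsum : ∀ v, permPattern₄ v =
      (∑ t, g t (v 0) (v 1) * h t (v 2) (v 3)) + b (v 0) (v 2) * b' (v 1) (v 3) + c (v 0) (v 3) * c' (v 1) (v 2))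
    (hb : b 0 0 = 0 ∧ b 1 1 = 0 ∧ b 1 0 = b 0 1 ∧ b 0 2 = 0 ∧ b 0 3 = 0 ∧ b 1 2 = 0 ∧ b 1 3 = 0)
    (hc : c 0 0 = 0 ∧ c 1 1 = 0 ∧ c 1 0 = c 0 1 ∧ c 0 2 = 0 ∧ c 0 3 = 0 ∧ c 1 2 = 0 ∧ c 1 3 = 0)
    (hb' : b' 0 0 = 0 ∧ b' 1 1 = 0 ∧ b' 0 1 = -b' 1 0 ∧ b' 2 0 = 0 ∧ b' 3 0 = 0 ∧ b' 2 1 = 0 ∧ b' 3 1 = 0 ∧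
      b' 0 2 = 0 ∧ b' 1 2 = 0 ∧ b' 2 2 = 0 ∧ b' 0 3 = 0 ∧ b' 1 3 = 0 ∧ b' 3 3 = 0 ∧ b' 3 2 = b' 2 3)
    (hc' : c' 0 0 = 0 ∧ c' 1 1 = 0 ∧ c' 0 1 = -c' 1 0 ∧ c' 2 0 = 0 ∧ c' 3 0 = 0 ∧ c' 2 1 = 0 ∧ c' 3 1 = 0 ∧
      c' 0 2 = 0 ∧ c' 1 2 = 0 ∧ c' 2 2 = 0 ∧ c' 0 3 = 0 ∧ c' 1 3 = 0 ∧ c' 3 3 = 0 ∧ c' 3 2 = c' 2 3)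
    (hrel : b 0 1 * b' 2 3 = 1 ∧ c 0 1 * c' 2 3 = 1 ∧ b 0 1 * b' 1 0 + c 0 1 * c' 1 0 = 0) : False := by
  classical
  obtain ⟨b00, b11, b10, b02, b03, b12, b13⟩ := hb
  obtain ⟨c00, c11, c10, c02, c03, c12, c13⟩ := hc
  obtain ⟨bp00, bp11, bp01, bp20, bp30, bp21, bp31, bp02, bp12, bp22, bp03, bp13, bp33, bp32⟩ := hb'
  obtain ⟨cp00, cp11, cp01, cp20, cp30, cp21, cp31, cp02, cp12, cp22, cp03, cp13, cp33, cp32⟩ := hc'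
  obtain ⟨r1, r2, -⟩ := hrel
  -- the mirror decomposition
  have hsumM : ∀ v, permPattern₄ v = (∑ t ∈ (Finset.univ : Finset (Fin 3)),
      (fun v => (fun x y => g t y x) (v 0) (v 1) * (fun i j => h t j i) (v 2) (v 3)) v) +
      b' (v 0) (v 2) * b (v 1) (v 3) + c' (v 0) (v 3) * c (v 1) (v 2) := by
    intro v
    rw [← permPattern_mirror v, hsum]
    simp only [Matrix.cons_val_zero, Matrix.cons_val_one, Matrix.head_cons, Matrix.cons_val_two, Matrix.tail_cons,
      Matrix.cons_val_three]
    ring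
  obtain ⟨π, hB2, hC2, hBp2, hCp2, hrel2⟩ := e3_dichotomy Finset.univ
    (fun t => fun v => (fun x y => g t y x) (v 0) (v 1) * (fun i j => h t j i) (v 2) (v 3)) (fun _ => {0, 1})
    (fun t _ => isSplitTerm_pair01 (fun x y => g t y x) (fun i j => h t j i)) (fun _ _ => Or.inr rfl) (by simp)
    b' b c' c hsumM
  simp only at hB2 hC2 hBp2 hCp2 hrel2
  -- where does `π` send `0, 1`?  (`b'` is symmetric and non-zero only on `{2,3}`)
  obtain ⟨-, -, hsym, -, -, -, -⟩ := hB2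
  have q1 := hrel2.1
  have hnz : b' (π 0) (π 1) ≠ 0 := fun h0 => by rw [h0, zero_mul] at q1; exact zero_ne_one q1
  have hinj : ∀ i j : Fin 4, π i = π j → i = j := fun i j hij => π.injective hij
  obtain ⟨p, hp⟩ : ∃ p, π 0 = p := ⟨_, rfl⟩
  obtain ⟨q, hq⟩ : ∃ q, π 1 = q := ⟨_, rfl⟩
  obtain ⟨r, hr⟩ : ∃ r, π 2 = r := ⟨_, rfl⟩
  obtain ⟨s, hs⟩ : ∃ s, π 3 = s := ⟨_, rfl⟩
  have hpq : p ≠ q := by rw [← hp, ← hq]; exact fun e => absurd (hinj _ _ e) (by decide)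
  have hpr : p ≠ r := by rw [← hp, ← hr]; exact fun e => absurd (hinj _ _ e) (by decide)
  have hps : p ≠ s := by rw [← hp, ← hs]; exact fun e => absurd (hinj _ _ e) (by decide)
  have hqr : q ≠ r := by rw [← hq, ← hr]; exact fun e => absurd (hinj _ _ e) (by decide)
  have hqs : q ≠ s := by rw [← hq, ← hs]; exact fun e => absurd (hinj _ _ e) (by decide)
  have hrs : r ≠ s := by rw [← hr, ← hs]; exact fun e => absurd (hinj _ _ e) (by decide)
  rw [hp, hq] at hsym hnz hrel2
  rw [hp, hq, hr, hs] at hBp2 hCp2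
  -- `π {0,1} = {2,3}`: the only symmetric non-zero entries of `b'`
  have hpq23 : (p = 2 ∧ q = 3) ∨ (p = 3 ∧ q = 2) := by
    fin_cases p <;> fin_cases q <;>
      simp only [Fin.zero_eta, Fin.mk_one, Fin.reduceFinMk, Fin.isValue] at hsym hnz hpq <;>
      first
      | exact absurd rfl hpq
      | exact absurd bp00 hnz | exact absurd bp11 hnz | exact absurd bp20 hnz | exact absurd bp30 hnz
      | exact absurd bp21 hnz | exact absurd bp31 hnz | exact absurd bp02 hnz | exact absurd bp12 hnz
      | exact absurd bp22 hnz | exact absurd bp03 hnz | exact absurd bp13 hnz | exact absurd bp33 hnz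
      | exact absurd (by linear_combination (bp01 - hsym) / 2) hnz
      | exact absurd (by linear_combination (bp01 + hsym) / 2) hnz
      | decide
  have hrs01 : (r = 0 ∧ s = 1) ∨ (r = 1 ∧ s = 0) := by
    rcases hpq23 with ⟨rfl, rfl⟩ | ⟨rfl, rfl⟩ <;> fin_cases r <;> fin_cases s <;>
      simp only [Fin.zero_eta, Fin.mk_one, Fin.reduceFinMk, Fin.isValue] at hpr hps hqr hqs hrs <;>
      first
      | exact absurd rfl hrs | exact absurd rfl hpr | exact absurd rfl hps | exact absurd rfl hqr
      | exact absurd rfl hqs | decide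
  -- the pinned rows `2, 3` of `b` and `c`, and the fourth scalar relation
  have pin : b 2 0 = 0 ∧ b 2 1 = 0 ∧ b 2 2 = 0 ∧ b 3 0 = 0 ∧ b 3 1 = 0 ∧ b 3 3 = 0 ∧ b 3 2 = -b 2 3 ∧
      c 2 0 = 0 ∧ c 2 1 = 0 ∧ c 2 2 = 0 ∧ c 3 0 = 0 ∧ c 3 1 = 0 ∧ c 3 3 = 0 ∧ c 3 2 = -c 2 3 ∧
      b' 2 3 * b 2 3 + c' 2 3 * c 2 3 = 0 := by
    obtain ⟨-, -, q3⟩ := hrel2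
    obtain ⟨x00, x11, x01, x20, x30, x21, x31, x02, x12, x22, x03, x13, x33, x32⟩ := hBp2
    obtain ⟨y00, y11, y01, y20, y30, y21, y31, y02, y12, y22, y03, y13, y33, y32⟩ := hCp2
    rcases hpq23 with ⟨rfl, rfl⟩ | ⟨rfl, rfl⟩ <;> rcases hrs01 with ⟨rfl, rfl⟩ | ⟨rfl, rfl⟩
    · exact ⟨x02, x03, x00, x12, x13, x11, by linear_combination x01, y02, y03, y00, y12, y13, y11,
        by linear_combination y01, by linear_combination -q3 + b' 2 3 * x01 + c' 2 3 * y01⟩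
    · exact ⟨x03, x02, x00, x13, x12, x11, by linear_combination x01, y03, y02, y00, y13, y12, y11,
        by linear_combination y01, by linear_combination -q3 + b' 2 3 * x01 + c' 2 3 * y01⟩
    · exact ⟨x12, x13, x11, x02, x03, x00, x01, y12, y13, y11, y02, y03, y00, y01,
        by rw [bp32, cp32] at q3; exact q3⟩
    · exact ⟨x13, x12, x11, x03, x02, x00, x01, y13, y12, y11, y03, y02, y00, y01,
        by rw [bp32, cp32] at q3; exact q3⟩
  clear hBp2 hCp2 hrel2 hC2 hsym hnz hpq23 hrs01 hpq hpr hps hqr hqs hrs hp hq hr hs hinj hsumM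
  obtain ⟨b20, b21, b22, b30, b31, b33, b32, c20, c21, c22, c30, c31, c33, c32, r4⟩ := pin
  -- the span of the three noise matrices
  let W : Submodule ℂ (Matrix (Fin 4) (Fin 4) ℂ) :=
    Submodule.span ℂ ((Finset.univ.image fun t : Fin 3 => Matrix.of (h t) : Finset _) : Set (Matrix (Fin 4) (Fin 4) ℂ))
  have hW : finrank ℂ W ≤ 3 :=
    (finrank_span_finset_le_card (R := ℂ) _).trans (Finset.card_image_le.trans (by simp))
  -- `D(ψ,φ) = Q - (Bψ)(B'φ)ᵀ - (C'φ)(Cψ)ᵀ` lies in `W`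
  have hD : ∀ ψ φ : Fin 4 → ℂ, contract₀₁ permPattern₄ ψ φ -
      vecMulVec (fun i => ∑ x, ψ x * b x i) (fun j => ∑ y, φ y * b' y j) -
      vecMulVec (fun i => ∑ y, φ y * c' y i) (fun j => ∑ x, ψ x * c x j) ∈ W := by
    intro ψ φ
    have : contract₀₁ permPattern₄ ψ φ = (∑ t, (∑ x, ∑ y, ψ x * φ y * g t x y) • Matrix.of (h t)) +
        vecMulVec (fun i => ∑ x, ψ x * b x i) (fun j => ∑ y, φ y * b' y j) +
        vecMulVec (fun i => ∑ y, φ y * c' y i) (fun j => ∑ x, ψ x * c x j) := by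
      rw [contract_congr hsum]
      have hsplit : (fun v => (∑ t, g t (v 0) (v 1) * h t (v 2) (v 3)) + b (v 0) (v 2) * b' (v 1) (v 3) +
          c (v 0) (v 3) * c' (v 1) (v 2)) = fun v => ∑ k : Fin 3, (![fun v => ∑ t, g t (v 0) (v 1) * h t (v 2) (v 3),
          fun v => b (v 0) (v 2) * b' (v 1) (v 3), fun v => c (v 0) (v 3) * c' (v 1) (v 2)] :
            Fin 3 → (Fin 4 → Fin 4) → ℂ) k v := by
        funext v; simp [Fin.sum_univ_three]
      rw [contract_congr (fun v => congrFun hsplit v), contract_sum, Fin.sum_univ_three]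
      simp only [Matrix.cons_val_zero, Matrix.cons_val_one, Matrix.head_cons, Matrix.cons_val_two, Matrix.tail_cons]
      rw [contract_sum (Finset.univ : Finset (Fin 3)) (fun t v => g t (v 0) (v 1) * h t (v 2) (v 3)),
        contract_pair02, contract_pair03]
      congr 1; congr 1
      exact Finset.sum_congr rfl fun t _ => contract_pair01 _ _ ψ φ
    rw [this, show ∀ A B C : Matrix (Fin 4) (Fin 4) ℂ, A + B + C - B - C = A from fun A B C => by abel]
    refine Submodule.sum_mem _ fun t _ => Submodule.smul_mem _ _ (Submodule.subset_span ?_)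
    simp only [Finset.coe_image, Finset.coe_univ, Set.image_univ, Set.mem_range]
    exact ⟨t, rfl⟩
  -- the matrices `D(e_z, e_w)` and their entries
  set Dm : Fin 4 → Fin 4 → Matrix (Fin 4) (Fin 4) ℂ := fun z w =>
    contract₀₁ permPattern₄ (Pi.single z 1) (Pi.single w 1) -
      vecMulVec (fun i => ∑ x, (Pi.single z (1 : ℂ) : Fin 4 → ℂ) x * b x i)
        (fun j => ∑ y, (Pi.single w (1 : ℂ) : Fin 4 → ℂ) y * b' y j) -
      vecMulVec (fun i => ∑ y, (Pi.single w (1 : ℂ) : Fin 4 → ℂ) y * c' y i)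
        (fun j => ∑ x, (Pi.single z (1 : ℂ) : Fin 4 → ℂ) x * c x j) with hDm
  have hDmW : ∀ z w, Dm z w ∈ W := fun z w => hD _ _
  have hDm_apply : ∀ z w i j, Dm z w i j =
      contract₀₁ permPattern₄ (Pi.single z 1) (Pi.single w 1) i j - b z i * b' w j - c' w i * c z j := by
    intro z w i j
    simp [hDm, vecMulVec_apply, Pi.single_apply, Finset.sum_ite_eq']
  have hQs : ∀ z w i j, contract₀₁ permPattern₄ (Pi.single z (1 : ℂ)) (Pi.single w 1) i j =
      if i ≠ j ∧ z ≠ w ∧ z ≠ i ∧ z ≠ j ∧ w ≠ i ∧ w ≠ j then 1 else 0 := by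
    intro z w i j
    rw [contract_permPattern_entries]
    fin_cases z <;> fin_cases w <;> fin_cases i <;> fin_cases j <;> simp
  -- four independent elements
  have key : ∀ (v : Fin 4 → Fin 4 × Fin 4), (∀ e : Fin 4 → ℂ,
      (∑ k, e k • Dm (v k).1 (v k).2) = 0 → ∀ k, e k = 0) → False := by
    intro v hv
    refine four_not_in_span_three W hW (fun k => ⟨Dm (v k).1 (v k).2, hDmW _ _⟩) ?_
    apply LinearIndependent.of_comp W.subtype
    rw [Fintype.linearIndependent_iff]
    intro e he
    exact hv e (by simpa using he)
  have entry : ∀ (v : Fin 4 → Fin 4 × Fin 4) (e : Fin 4 → ℂ), (∑ k, e k • Dm (v k).1 (v k).2) = 0 →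
      ∀ i j, ∑ k, e k * Dm (v k).1 (v k).2 i j = 0 := by
    intro v e he i j
    have := congrFun (congrFun he i) j
    simpa [Matrix.sum_apply, Matrix.smul_apply] using this
  -- closed forms of the four arrays
  obtain ⟨l, hl⟩ : ∃ x, b 0 1 = x := ⟨_, rfl⟩
  obtain ⟨ρ, hρ⟩ : ∃ x, b 2 3 = x := ⟨_, rfl⟩
  obtain ⟨β, hβ⟩ : ∃ x, b' 1 0 = x := ⟨_, rfl⟩
  obtain ⟨σ, hσ⟩ : ∃ x, b' 2 3 = x := ⟨_, rfl⟩
  obtain ⟨l', hl'⟩ : ∃ x, c 0 1 = x := ⟨_, rfl⟩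
  obtain ⟨ρ', hρ'⟩ : ∃ x, c 2 3 = x := ⟨_, rfl⟩
  obtain ⟨γ, hγ⟩ : ∃ x, c' 1 0 = x := ⟨_, rfl⟩
  obtain ⟨τ, hτ⟩ : ∃ x, c' 2 3 = x := ⟨_, rfl⟩
  have hbM : ∀ i j, b i j = !![0, l, 0, 0; l, 0, 0, 0; 0, 0, 0, ρ; 0, 0, -ρ, 0] i j := by
    intro i j
    fin_cases i <;> fin_cases j <;>
      simp [b00, b11, b10, b02, b03, b12, b13, b20, b21, b22, b30, b31, b33, b32, hl, hρ]
  have hb'M : ∀ i j, b' i j = !![0, -β, 0, 0; β, 0, 0, 0; 0, 0, 0, σ; 0, 0, σ, 0] i j := by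
    intro i j
    fin_cases i <;> fin_cases j <;>
      simp [bp00, bp11, bp01, bp20, bp30, bp21, bp31, bp02, bp12, bp22, bp03, bp13, bp33, bp32, hβ, hσ]
  have hcM : ∀ i j, c i j = !![0, l', 0, 0; l', 0, 0, 0; 0, 0, 0, ρ'; 0, 0, -ρ', 0] i j := by
    intro i j
    fin_cases i <;> fin_cases j <;>
      simp [c00, c11, c10, c02, c03, c12, c13, c20, c21, c22, c30, c31, c33, c32, hl', hρ']
  have hc'M : ∀ i j, c' i j = !![0, -γ, 0, 0; γ, 0, 0, 0; 0, 0, 0, τ; 0, 0, τ, 0] i j := by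
    intro i j
    fin_cases i <;> fin_cases j <;>
      simp [cp00, cp11, cp01, cp20, cp30, cp21, cp31, cp02, cp12, cp22, cp03, cp13, cp33, cp32, hγ, hτ]
  have r4' : σ * ρ + τ * ρ' = 0 := by rw [← hσ, ← hρ, ← hτ, ← hρ']; exact r4
  by_cases hk : 1 + γ * ρ' = 0
  · refine key ![(0, 1), (2, 3), (2, 1), (3, 0)] fun e he k => ?_
    have e23 := entry _ e he 2 3
    have e32 := entry _ e he 3 2
    have e01 := entry _ e he 0 1
    have e03 := entry _ e he 0 3
    have e12 := entry _ e he 1 2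
    simp [Fin.sum_univ_four, hDm_apply, hQs, hbM, hb'M, hcM, hc'M, -mul_eq_zero] at e23 e32 e01 e03 e12
    have h0 : e 0 = 0 := by linear_combination (e23 + e32 + e 1 * r4') / 2
    have h1 : e 1 = 0 := by linear_combination e01 + γ * l' * h0
    have h2 : e 2 = 0 := by linear_combination (e03 + e 2 * hk) / 2
    have h3 : e 3 = 0 := by linear_combination (e12 + e 3 * hk) / 2
    fin_cases k <;> assumption
  · refine key ![(0, 1), (2, 3), (2, 0), (3, 1)] fun e he k => ?_
    have e23 := entry _ e he 2 3
    have e32 := entry _ e he 3 2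
    have e01 := entry _ e he 0 1
    have e13 := entry _ e he 1 3
    have e02 := entry _ e he 0 2
    simp [Fin.sum_univ_four, hDm_apply, hQs, hbM, hb'M, hcM, hc'M, -mul_eq_zero] at e23 e32 e01 e13 e02
    have h0 : e 0 = 0 := by linear_combination (e23 + e32 + e 1 * r4') / 2
    have h1 : e 1 = 0 := by linear_combination e01 + γ * l' * h0
    have h2 : e 2 = 0 :=
      (mul_eq_zero.1 (by linear_combination e13 : e 2 * (1 + γ * ρ') = 0)).resolve_right hk
    have h3 : e 3 = 0 :=
      (mul_eq_zero.1 (by linear_combination e02 : e 3 * (1 + γ * ρ') = 0)).resolve_right hk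
    fin_cases k <;> assumption

/-! ### §3 The profile `(3,1,1)` -/

/-- **The border profile `(3,1,1)` is impossible exactly**: `P₄` is not a sum of three pair terms on `01|23`, one on
`02|13` and one on `03|12`. -/
theorem profile_311 (g h : Fin 3 → Fin 4 → Fin 4 → ℂ) (b b' c c' : Fin 4 → Fin 4 → ℂ)
    (hsum : ∀ v, permPattern₄ v =
      (∑ t, g t (v 0) (v 1) * h t (v 2) (v 3)) + b (v 0) (v 2) * b' (v 1) (v 3) + c (v 0) (v 3) * c' (v 1) (v 2)) :
    False := by
  classical
  obtain ⟨π, hB, hC, hBp, hCp, hrel⟩ := e3_dichotomy Finset.univ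
    (fun t => fun v => g t (v 0) (v 1) * h t (v 2) (v 3)) (fun _ => {0, 1})
    (fun t _ => isSplitTerm_pair01 (g t) (h t)) (fun _ _ => Or.inr rfl) (by simp) b b' c c' (fun v => by rw [hsum v])
  simp only at hB hC hBp hCp hrel
  have hsum' := hsum_letterPerm π Finset.univ (fun t => fun v => g t (v 0) (v 1) * h t (v 2) (v 3)) b b' c c'
    (fun v => by rw [hsum v])
  simp only [letterPerm_pair01] at hsum'
  exact profile_311_of_shape (fun t x y => g t (π x) (π y)) (fun t i j => h t (π i) (π j))
    (fun x z => b (π x) (π z)) (fun y w => b' (π y) (π w)) (fun x w => c (π x) (π w)) (fun y z => c' (π y) (π z))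
    (fun v => by rw [hsum' v]) hB hC hBp hCp hrel

end LaplaceFourLine

end Summit.ValiantsHypothesis.ValiantsHypothesis.Theorems.RigidityForcesSymmetryRankRigidMinimalRepr
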